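import Summits.KontsevichZagierPeriods.Zeta5Search.TwoTaleOmega.StepER
import Summits.KontsevichZagierPeriods.Zeta5Search.TwoTaleOmega.StepAL

/-!
# (bmiss)@Ω — direction `a`, second tale: motion of the data along `δ_a` (cell `pub-zeta5`, cert-1 gen 4)

HONEST FRAMING: systematic search; recurrence certificates; no irrationality claim unless certified. Pure finite algebra
over `ℚ`; no named fact, no `sorry`.

Kit for `StepAR` (direction `δ = a`, side `R`): the sign/Γ-factor motion `(−1)^k κ(p+kδ)·∏_{j<k}(f−a−k+e+j) = κ(p)`
(`kap_addA`), the Γ-ratio `F_R(p+kδ;u)·block_u(a+1,a+1+k)·block_t(a−b+1,a−b+1+k)·∏ = (−1)^k block_u(g−b+a,g−b+a+k)·block_t(a,a+k)·F_R(p;u)`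
(`vR_ratio_addA`), and the generic second-tale node move to any common node `M` with `nodeR(q) ≤ M ≤ −q.a` (`altE_nodeR_to`).
-/

noncomputable section

open Finset Polynomial
open Literature.NumberTheory.Irrationality.Zudilin2014
open Summit.KontsevichZagierPeriods.Zeta5Search.FormalBarnes
open Summit.KontsevichZagierPeriods.Zeta5Search.Certificates.TwoTaleTelescope

namespace Summit.KontsevichZagierPeriods.Zeta5Search.TwoTaleOmega

namespace Pt

variable (p : Pt)

/-! ### Motion along `δ_a` in the second tale -/

/-- `ε` alternates along `δ_a`. -/
theorem eps_addA (k : ℕ) : (p.addA k).eps = (-1) ^ k * p.eps := by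
  unfold eps
  rw [neg_one_pow_natAbs, neg_one_pow_natAbs, show (p.addA k).a + (p.addA k).b + (p.addA k).e + (p.addA k).f
    = (p.a + p.b + p.e + p.f) + (k : ℕ) by simp only [addA_a, addA_b, addA_e, addA_f]; ring, zpow_add₀ (by norm_num),
    zpow_natCast]
  ring

/-- `κ` along `δ_a`: `(−1)^k κ(p+kδ_a) · ∏_{j<k}(f−a−k+e+j) = κ(p)` (for `f − a − k + e − 1 ≥ 0`). -/
theorem kap_addA (k : ℕ) (h1 : 0 ≤ p.f - p.a - k + p.e - 1) :
    (-1) ^ k * (p.addA k).kap * (∏ j ∈ range k, ((p.f : ℚ) - p.a - k + p.e - 1 + j + 1)) = p.kap := by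
  have f1 := facZ_add_nat h1 k
  rw [show p.f - p.a - (k : ℤ) + p.e - 1 + k = p.f - p.a + p.e - 1 by ring] at f1
  unfold kap
  rw [eps_addA, f1]
  simp only [addA_a, addA_b, addA_e, addA_f, addA_g]
  rw [show p.f - (p.a + (k : ℤ)) + p.e - 1 = p.f - p.a - k + p.e - 1 by ring]
  push_cast
  have hsq : ((-1 : ℚ) ^ k) * ((-1 : ℚ) ^ k) = 1 := by rw [← mul_pow]; norm_num
  linear_combination (p.eps * (facZ (p.e - 1) * (facZ (p.f - p.a - k + p.e - 1)
    * ∏ j ∈ range k, ((p.f : ℚ) - p.a - k + p.e - 1 + j + 1)) * facZ (p.f - 1)) / facZ (p.g - p.b - 1)) * hsq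

variable {p}

/-- **Γ-ratio along `δ_a`, second tale**:
`F_R(p+kδ;u)·block(a+1,a+1+k)(u)·block(a−b+1,a−b+1+k)(u/2)·∏_{j<k}(f−a−k+e+j) = (−1)^k·block(g−b+a,g−b+a+k)(u)·block(a,a+k)(u/2)·F_R(p;u)`. -/
theorem vR_ratio_addA (h : p.Omega) (k : ℕ) (hk : (p.addA k).Omega) {u : ℚ} (hu : ∀ K ∈ Icc 1 (4 * p.g), u + K ≠ 0) :
    (p.addA k).vR.eval u * ((block (p.a + 1) (p.a + 1 + k)).eval u * (block (p.a - p.b + 1) (p.a - p.b + 1 + k)).eval (u / 2)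
      * (∏ j ∈ range k, ((p.f : ℚ) - p.a - k + p.e - 1 + j + 1)))
      = (-1) ^ k * (block (p.g - p.b + p.a) (p.g - p.b + p.a + k)).eval u * (block p.a (p.a + k)).eval (u / 2) * p.vR.eval u := by
  obtain ⟨o1, o2, o3, o4, o5, o6, o7, o8, o9⟩ := id h
  have hp := h.pos
  have k1 := hk.twoE; have k2 := hk.twoF; have k6 := hk.b_ge; have k7 := hk.a_lt_g; have k3 := hk.e_le; have k4 := hk.f_le
  simp only [addA_a, addA_b, addA_e, addA_f, addA_g] at k1 k2 k6 k7 k3 k4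
  have hden : (denT p.t2a p.t2b).eval (u / 2) ≠ 0 := denT_ne_zero_Icc h hu
  have hdenk : (denT (p.addA k).t2a (p.addA k).t2b).eval (u / 2) ≠ 0 := denT_ne_zero_Icc hk (by simpa using hu)
  have hkap := kap_addA p k (by omega)
  rw [vR_eval_blocks _ hk.admissibleT hdenk, vR_eval_blocks _ h.admissibleT hden]
  simp only [addA_a, addA_b, addA_e, addA_f, addA_g]
  rw [denT_eq, Polynomial.eval_mul] at hden hdenk
  simp only [addA_a, addA_e, addA_f, addA_g] at hdenk
  -- split the blocks of `p` into the blocks of `p + kδ` and the moving factors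
  rw [show p.a + (k : ℤ) + 1 = p.a + 1 + k by ring, show p.g - p.b + (p.a + (k : ℤ)) = p.g - p.b + p.a + k by ring,
    show p.a + (k : ℤ) - p.b + 1 = p.a - p.b + 1 + k by ring]
  have eB2 : block (p.a + 1) (p.g - p.b + p.a) * block (p.g - p.b + p.a) (p.g - p.b + p.a + k)
      = block (p.a + 1) (p.a + 1 + k) * block (p.a + 1 + k) (p.g - p.b + p.a + k) := by
    rw [block_mul_block (by omega) (by omega), block_mul_block (by omega) (by omega)]
  have eBh : block (p.a - p.b + 1) p.f = block (p.a - p.b + 1) (p.a - p.b + 1 + k) * block (p.a - p.b + 1 + k) p.f :=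
    (block_mul_block (by omega) (by omega)).symm
  have eDa : block p.a p.g = block p.a (p.a + k) * block (p.a + k) p.g := (block_mul_block (by omega) (by omega)).symm
  have eB2' := congrArg (Polynomial.eval u) eB2
  simp only [Polynomial.eval_mul] at eB2'
  rw [eBh, eDa]
  rw [eDa] at hden
  simp only [Polynomial.eval_mul] at hden ⊢
  have hE : (block p.e (p.e + p.f)).eval (u / 2) ≠ 0 := fun h0 => hden (by rw [h0, zero_mul])
  have hDak : (block (p.a + ↑k) p.g).eval (u / 2) ≠ 0 := fun h0 => hdenk (by rw [h0, mul_zero])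
  have hDa0 : (block p.a (p.a + ↑k)).eval (u / 2) ≠ 0 := fun h0 => hden (by rw [h0, zero_mul, mul_zero])
  rw [div_mul_eq_mul_div, mul_div_assoc', div_eq_div_iff (mul_ne_zero hE hDak) (mul_ne_zero hE (mul_ne_zero hDa0 hDak))]
  -- replace κ(p) by the κ(p+kδ) expression and close by ring using the block identity in `u`
  rw [← hkap]
  have hsq : ((-1 : ℚ) ^ k) * ((-1 : ℚ) ^ k) = 1 := by rw [← mul_pow]; norm_num
  linear_combination (-((p.addA k).kap * (block (p.a - p.b + 1 + k) p.f).eval (u / 2)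
      * (block (p.a - p.b + 1) (p.a - p.b + 1 + k)).eval (u / 2) * (∏ j ∈ range k, ((p.f : ℚ) - p.a - k + p.e - 1 + j + 1))
      * (block p.e (p.e + p.f)).eval (u / 2) * (block (p.a + k) p.g).eval (u / 2) * (block p.a (p.a + k)).eval (u / 2))) * eB2'
    + (-((p.addA k).kap * (block (p.a - p.b + 1 + k) p.f).eval (u / 2)
      * (block (p.a - p.b + 1) (p.a - p.b + 1 + k)).eval (u / 2) * (∏ j ∈ range k, ((p.f : ℚ) - p.a - k + p.e - 1 + j + 1))
      * (block p.e (p.e + p.f)).eval (u / 2) * (block (p.a + k) p.g).eval (u / 2) * (block p.a (p.a + k)).eval (u / 2)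
      * (block (p.g - p.b + p.a) (p.g - p.b + p.a + k)).eval u * (block (p.a + 1) (p.g - p.b + p.a)).eval u)) * hsq

/-- **Second-tale node move to a common node `M`** for any point of Ω: if `nodeR(q) ≤ M ≤ −q.a` then
`E_{nodeR(q)}[vR q] = E_M[vR q]` in both coordinates. -/
theorem altE_nodeR_to {q : Pt} (hq : q.Omega) (M : ℤ) (d : ℕ) (h1 : q.nodeR ≤ M) (h2 : M + q.a ≤ 0) :
    altE0 d q.nodeR q.vR = altE0 d M q.vR ∧ altE1 q.nodeR q.vR = altE1 M q.vR := by
  have hnode : q.nodeR = 1 - a0star q.t2a := rfl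
  obtain ⟨n, hn⟩ : ∃ n : ℕ, M = q.nodeR + n := ⟨(M - q.nodeR).toNat, by rw [Int.toNat_of_nonneg (by omega)]; ring⟩
  rw [hn]
  exact altE_vR_move hq _ n d (by rw [hnode]) (by omega)

end Pt

end Summit.KontsevichZagierPeriods.Zeta5Search.TwoTaleOmega

end
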